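import Summits.QuantumFields.YangMills.Theorems.UnitScaleTiltProp7OneFormConjugateResolventOfLetters
import Summits.QuantumFields.YangMills.Theorems.UnitScaleTiltProp7OneFormAgmonBilinearPhaseClass
import HarnessLib

/-!
# Route `UnitScaleTilt`, crux K1 «MinimiserStabilityRegPr» (stmt-QuantumFields-19200), EX rows `h137kπ` ∕ `h137kΔ` ∕ `hCk` — **K-STOREY BRICK (K2b-δ₃)-D (px12 g17): THE `δ₃` CLASS LETTER
# OF px10 g13's (K2-KNIT) ✓∕⧗`Prop7KinvRowOfConjLetters` — `hres : ∀ φ, (|φ x − φ x′| ≤ r·η·tdist x x′) → ∀ M_f M_fi (rows at e^{±φ∘src}), ∀ x, ‖M_f(G_T(M_fi x)) − G_T x‖ ≤ δ₃‖x‖`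
# AT THE SLOT OF RECORD, FROM THE DISPLAYED MEMBER LETTERS (γ) `hco`, (C_V) `hVlow`, `hk` (the EX row `h349`'s kernel text), `hQ`** — (K2b-δ₃)-C ✓∕⧗`conj_resolvent_oneForm_of_letters` at
# `w = e^{φ}` with the majorant `d₁ := √3·r·e^{r}` (`ρ = e^{rη} − 1 ≤ rη·e^{rη}`, `η ≤ 1`), θ_V := A2g ✓`hVconj_phaseClass_of_letters`' constant and θ₂ := B3 ✓∕⧗`hVconj₂_phaseClass_of_letters`'
# constant (THE SAME NUMBER `θ_V(r)`), both majorised by ONE displayed real `θ_r ≥ θ_V(r)` so that `δ₃ = δ₃(γ, C_V, r, θ_r, ε)` is a short formula.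

Cell `ym3-torus` (HUMAN RULING D-0037: SU(2) YM₃ on T³ is ladder rung R3 — NOT d = 4, NOT infinite volume, NOT a mass gap, NOT Clay).  Width seat `ym3-torus-px12` gen 17.  THEOREMS ONLY
(0 `def`, 0 `sorry`, default heartbeats); `--supports stmt-QuantumFields-19200 --as helper`, count-neutral.  HONEST LABEL: instantiation; CONDITIONAL on `PosOnto` (✓p767766 `posOnto_of_coercive`),
(γ) (✓p767766 `hco_DeltaEtaSlot_exists`), (C_V) (px21 ✓p768234 `hVlow_abs_of_lift`), `hk` (✓`kernelRow349_allMembers_exists` under Lift), `hQ` (✓`norm_Qk_le_of_regPr`); nothing of (3.132), `h137kπ`,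
`h137kΔ`, `hCk`, EX or 19200 is proved here.

WHAT IS PROVED (ns `Summit.QuantumFields.YangMills.Theorems.Prop7OneFormConjugateResolventPhaseClass`; member `F`, `h : n ≤ K`, weights `c₀ cB`, coupling `a`).
* `ratio_rows_of_phaseClass` — for `|φ x − φ x′| ≤ rη·tdist x x′`: both bond ratios of `e^{φ}` are `≤ e^{rη} − 1` and `3η⁻²(e^{rη} − 1)² ≤ (√3·r·e^{r})²`.
* ★★★ `conj_resolvent_oneForm_phaseClass` — THE CLASS LETTER ABOVE with
  `δ₃ = γ^{−1∕2}·(d₁√(1+C_V∕γ)Θ⁻¹ + d₁γ^{−1∕2}√((Θ⁻¹ + c₁Θ⁻²)∕(1−ε)) + (d₁² + θ_r)γ^{−1∕2}Θ⁻¹)`, `d₁ = √3·r·e^{r}`, `Θ = (1−ε)γ − εC_V − d₁²(1+1∕ε) − θ_r > 0`, `c₁ = d₁²(1+1∕ε) + C_V + θ_r`.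
HYP-SAT (★★OWNER RULING №42): as listed; the numeric rows `hθr` (one real inequality naming A2g's `θ_V(r)`) and `hΘ` are inhabited for `r`, `ε` small once `γ > 0` (every constant K-free at the
pins); nothing eventual; no hypothesis restates the conclusion.

References: T. Bałaban, CMP **99** (1985) 389–434 [Balaban1985BackgroundPropagators] ((3.26) p.395, Thm 3.1 (3.46) p.398, (3.49) p.399, (3.132) p.422); CMP **102** (1985) 277–309
[Balaban1985Variational] ((134)–(136) p.298); S. Agmon, *Lectures on exponential decay* (Princeton 1982) Ch. 1 [Agmon1982].
-/

set_option autoImplicit false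

noncomputable section

open scoped BigOperators Matrix.Norms.L2Operator InnerProductSpace ComplexConjugate

namespace Summit.QuantumFields.YangMills.Theorems.Prop7OneFormConjugateResolventPhaseClass

open Literature.MathematicalPhysics.QuantumFieldTheory.Balaban1983to89
open Literature.MathematicalPhysics.QuantumFieldTheory.Balaban1983to89.T3ContinuumYM3Torus
open T3SectALandauChart (eta eta_pos bgUnits formComp)
open T3PrintedRegularMinimiser (RegPr)
open B11Eq103H1Complex (SiteL2K BondL2K)
open B5Eq118OneStroke (iterBlockOf)
open B3Taylor310LocalRemainder (tdist_comm)
open Literature.Analysis.ODE (exp_sub_one_le_mul_exp)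
open Literature.MathematicalPhysics.QuantumFieldTheory.Balaban1983to89.Beta.CombesThomasForm (abs_exp_sub_one_le)
open Summit.QuantumFields.YangMills.Theorems.Prop7SectET3Transport (periodsT3)
open Summit.QuantumFields.YangMills.Theorems.Prop7SectET3HilbertLetters (W₂ toL2 toL2S DL2 DstarL2)
open Summit.QuantumFields.YangMills.Theorems.Prop7SectET3WilsonHessian (DeltaEta DeltaEtaSlot)
open Summit.QuantumFields.YangMills.Theorems.Prop7SectET3GaugeProjector (RS)
open Summit.QuantumFields.YangMills.Theorems.Prop7SectET3CurvedPropagators (laplaceA Qk GT PosOnto)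
open Summit.QuantumFields.YangMills.Theorems.Prop7BlockDistanceWeights (tdist_src_tgt_le_one)
open Summit.QuantumFields.YangMills.Theorems.Prop7TwistedSliceGaugeOntoTower (eta_le_one)
open Summit.QuantumFields.YangMills.Theorems.Prop7OneFormAgmonPhaseClass (hVconj_phaseClass_of_letters)
open Summit.QuantumFields.YangMills.Theorems.Prop7OneFormAgmonBilinearPhaseClass (hVconj₂_phaseClass_of_letters)
open Summit.QuantumFields.YangMills.Theorems.Prop7OneFormConjugateResolventOfLetters (conj_resolvent_oneForm_of_letters)

variable (F : T3Family) {n K : ℕ} (h : n ≤ K) (c₀ cB : ℝ) [Fact (0 < c₀)] [Fact (0 < cB)] {a : ℝ}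

omit [Fact (0 < c₀)] [Fact (0 < cB)] in
/-- **THE WEIGHT ROWS OF THE PHASE CLASS**: for `|φ x − φ x′| ≤ r·η·tdist x x′` (`0 ≤ r`) both bond ratios of `e^{φ}` are `≤ e^{rη} − 1`, and the gradient-defect majorant
`3η⁻²(e^{rη} − 1)² ≤ (√3·r·e^{r})²` (`e^{t} − 1 ≤ te^{t}`, `η ≤ 1`). [cite: Balaban1985BackgroundPropagators, Thm 3.1 (3.46) p.398; Agmon1982, Ch. 1] -/
theorem ratio_rows_of_phaseClass (φ : Site (F.P K) 0 → ℝ) {r : ℝ} (hr : 0 ≤ r)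
    (hφ' : ∀ x x' : Site (F.P K) 0, |φ x - φ x'| ≤ r * eta F n K * (Site.tdist x x' : ℝ)) :
    (∀ b : PBond (F.P K) 0, |Real.exp (φ b.tgt) / Real.exp (φ b.src) - 1| ≤ Real.exp (r * eta F n K) - 1) ∧
    (∀ b : PBond (F.P K) 0, |Real.exp (φ b.src) / Real.exp (φ b.tgt) - 1| ≤ Real.exp (r * eta F n K) - 1) ∧
    3 * ((eta F n K)⁻¹) ^ 2 * (Real.exp (r * eta F n K) - 1) ^ 2 ≤ (Real.sqrt 3 * r * Real.exp r) ^ 2 := by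
  have hη : 0 < eta F n K := eta_pos F n K
  have hη1 : eta F n K ≤ 1 := eta_le_one F (n := n) (K := K)
  have hφ : ∀ b : PBond (F.P K) 0, |φ b.tgt - φ b.src| ≤ r * eta F n K := fun b => by
    have h1 := hφ' b.tgt b.src
    have h2 : (Site.tdist b.tgt b.src : ℝ) ≤ 1 := by
      rw [tdist_comm]; exact_mod_cast tdist_src_tgt_le_one b
    calc |φ b.tgt - φ b.src| ≤ r * eta F n K * (Site.tdist b.tgt b.src : ℝ) := h1
      _ ≤ r * eta F n K * 1 := mul_le_mul_of_nonneg_left h2 (mul_nonneg hr hη.le)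
      _ = r * eta F n K := mul_one _
  refine ⟨fun b => ?_, fun b => ?_, ?_⟩
  · rw [← Real.exp_sub]; exact abs_exp_sub_one_le (hφ b)
  · rw [← Real.exp_sub]; exact abs_exp_sub_one_le (by rw [abs_sub_comm]; exact hφ b)
  · -- `e^{rη} − 1 ≤ rη·e^{rη} ≤ rη·e^{r}`
    have h0 : 0 ≤ Real.exp (r * eta F n K) - 1 := by
      have : 1 ≤ Real.exp (r * eta F n K) := Real.one_le_exp (by positivity)
      linarith
    have h1 : Real.exp (r * eta F n K) - 1 ≤ r * eta F n K * Real.exp r := by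
      refine (exp_sub_one_le_mul_exp _).trans (mul_le_mul_of_nonneg_left ?_ (by positivity))
      exact Real.exp_le_exp.mpr (by nlinarith)
    have h2 : (eta F n K)⁻¹ * (Real.exp (r * eta F n K) - 1) ≤ r * Real.exp r := by
      rw [inv_mul_le_iff₀ hη]
      calc Real.exp (r * eta F n K) - 1 ≤ r * eta F n K * Real.exp r := h1
        _ = eta F n K * (r * Real.exp r) := by ring
    have h3 : 0 ≤ (eta F n K)⁻¹ * (Real.exp (r * eta F n K) - 1) := by positivity
    calc 3 * ((eta F n K)⁻¹) ^ 2 * (Real.exp (r * eta F n K) - 1) ^ 2 = 3 * ((eta F n K)⁻¹ * (Real.exp (r * eta F n K) - 1)) ^ 2 := by ring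
      _ ≤ 3 * (r * Real.exp r) ^ 2 := by gcongr
      _ = (Real.sqrt 3 * r * Real.exp r) ^ 2 := by
          have e3 : Real.sqrt 3 ^ 2 = 3 := Real.sq_sqrt (by norm_num)
          rw [show (Real.sqrt 3 * r * Real.exp r) ^ 2 = Real.sqrt 3 ^ 2 * (r * Real.exp r) ^ 2 by ring, e3]

/-- ★★★ **THE `δ₃` CLASS LETTER OF THE (K2-KNIT), AT THE SLOT OF RECORD.**  `RegPr F n K ε₀ U₀` + routeR-w4's windows; `PosOnto` at `DeltaEtaSlot` (`hp`); `0 ≤ a`; `0 ≤ r < μ′`;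
the letters `hk` (the EX row `h349`'s kernel text, `Ck`, `μ′`), `hQ` (`0 ≤ C_Q`); the form letters (γ) `hco` (`0 < γ`) and (C_V) `hVlow` (`0 ≤ C_V`) — A3's texts at the slot; ONE real `θ_r` with
`hθr : θ_V(r) ≤ θ_r` (A2g's constant, displayed verbatim) and `0 < ε < 1` with `hΘ : 0 < (1−ε)γ − εC_V − (√3·r·e^{r})²(1+1∕ε) − θ_r`.  THEN for every phase `φ` with `|φ x − φ x′| ≤ r·η·tdist x x′`,
all linear `M_f ↔ e^{φ(b₋)}`, `M_fi ↔ e^{−φ(b₋)}` (rows) and all `x`: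
**`‖M_f(G_T(M_fi x)) − G_T x‖ ≤ γ^{−1∕2}·(d₁√(1+C_V∕γ)Θ⁻¹ + d₁γ^{−1∕2}√((Θ⁻¹ + c₁Θ⁻²)∕(1−ε)) + (d₁² + θ_r)γ^{−1∕2}Θ⁻¹)·‖x‖`**, `d₁ = √3·r·e^{r}`, `Θ = (1−ε)γ − εC_V − d₁²(1+1∕ε) − θ_r`,
`c₁ = d₁²(1+1∕ε) + C_V + θ_r` — px10 g13's `hres` VERBATIM with this `δ₃`. [cite: Balaban1985BackgroundPropagators, (3.26) p.395, Thm 3.1 (3.46) p.398, (3.49) p.399, (3.132) p.422; Agmon1982, Ch. 1] -/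
theorem conj_resolvent_oneForm_phaseClass {ε₀ : ℝ} (hε₀ : 0 < ε₀) (hε : 10 ^ 10 * (F.L : ℝ) ^ 6 * ε₀ ≤ 1) (hε12 : 10 ^ 12 * (F.L : ℝ) ^ 3 * ε₀ ≤ 1)
    (U₀ : GaugeField (F.P K) 0 (Matrix.specialUnitaryGroup (Fin 2) ℂ)) (hreg : RegPr F n K ε₀ U₀) (ha : 0 ≤ a)
    (hp : PosOnto F n K h c₀ cB a (DeltaEtaSlot F n K c₀) U₀)
    {r μ' Ck : ℝ} (hr : 0 ≤ r) (hrμ : r < μ') (hCk : 0 ≤ Ck)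
    (hk : ∀ (b : PBond (F.P K) 0) (Z : Matrix (Fin 2) (Fin 2) ℂ) (bd : PBond (F.P K) 0),
      ‖(toL2 F K c₀).symm (DL2 F n K c₀ U₀ (DstarL2 F n K c₀ U₀ (toL2 F K c₀ (Pi.single b Z)) - RS F n K h c₀ cB U₀ (DstarL2 F n K c₀ U₀ (toL2 F K c₀ (Pi.single b Z))))) bd‖
        ≤ Ck * Real.exp (-(μ' * (Site.tdist (P := F.P K) (iterBlockOf (K - n) b.src) (iterBlockOf (K - n) bd.src) : ℝ))) * ‖Z‖)
    {CQ : ℝ} (hCQ : 0 ≤ CQ) (hQ : ∀ v : BondL2K ℂ 3 (periodsT3 F K) c₀ W₂, ‖Qk F n K h c₀ cB U₀ v‖ ≤ CQ * ‖v‖)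
    {γ CV θr ε : ℝ} (hγ : 0 < γ) (hCV : 0 ≤ CV) (hε1p : 0 < ε) (hε1 : ε < 1)
    (hco : ∀ v : BondL2K ℂ 3 (periodsT3 F K) c₀ W₂, γ * ‖v‖ ^ 2 ≤ RCLike.re ⟪v, laplaceA F n K h c₀ cB a (DeltaEtaSlot F n K c₀) U₀ v⟫_ℂ)
    (hVlow : ∀ X : PBond (F.P K) 0 → Matrix (Fin 2) (Fin 2) ℂ,
      -(CV * ‖toL2 F K c₀ X‖ ^ 2) ≤ RCLike.re ⟪toL2 F K c₀ X, laplaceA F n K h c₀ cB a (DeltaEtaSlot F n K c₀) U₀ (toL2 F K c₀ X)⟫_ℂ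
        - ∑ μ : Fin (F.P K).d, ‖DL2 F n K c₀ U₀ (toL2S F K c₀ (formComp X μ))‖ ^ 2)
    (hθr : a * (2 * Real.sqrt (216 * (Real.exp (r * ((F.P K).d + 1)) - 1) ^ 2 * (cB / (c₀ * ((F.L : ℝ) ^ (K - n)) ^ 3))) * CQ
                  + 216 * (Real.exp (r * ((F.P K).d + 1)) - 1) ^ 2 * (cB / (c₀ * ((F.L : ℝ) ^ (K - n)) ^ 3)))
              + Real.sqrt 2 * Ck * (r * (F.P K).d * Real.exp (r * (F.P K).d) / min 1 ((μ' - r) / 2))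
                  * (((F.P K).d : ℝ) * ((((F.P K).L : ℝ) ^ (F.P K).d) ^ (K - n)) * (2 * (1 + 1 / (μ' - (r + min 1 ((μ' - r) / 2))))) ^ 3)
              + 32 * Real.sqrt 2 * ε₀ * (((F.P K).d : ℝ) * (2 * 3) ^ (F.P K).d) * (1 + Real.exp (2 * r)) ≤ θr)
    (hΘ : 0 < (1 - ε) * γ - ε * CV - (Real.sqrt 3 * r * Real.exp r) ^ 2 * (1 + 1 / ε) - θr) :
    ∀ φ : Site (F.P K) 0 → ℝ, (∀ x x' : Site (F.P K) 0, |φ x - φ x'| ≤ r * eta F n K * (Site.tdist x x' : ℝ)) →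
    ∀ (Mf Mfi : BondL2K ℂ 3 (periodsT3 F K) c₀ W₂ →ₗ[ℂ] BondL2K ℂ 3 (periodsT3 F K) c₀ W₂),
      (∀ X : PBond (F.P K) 0 → Matrix (Fin 2) (Fin 2) ℂ, Mf (toL2 F K c₀ X) = toL2 F K c₀ (fun b => Real.exp (φ b.src) • X b)) →
      (∀ X : PBond (F.P K) 0 → Matrix (Fin 2) (Fin 2) ℂ, Mfi (toL2 F K c₀ X) = toL2 F K c₀ (fun b => (Real.exp (φ b.src))⁻¹ • X b)) →
    ∀ x : BondL2K ℂ 3 (periodsT3 F K) c₀ W₂,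
      ‖Mf (GT F n K h c₀ cB a (DeltaEtaSlot F n K c₀) U₀ (Mfi x)) - GT F n K h c₀ cB a (DeltaEtaSlot F n K c₀) U₀ x‖
        ≤ (Real.sqrt γ)⁻¹ * ((Real.sqrt 3 * r * Real.exp r) * Real.sqrt (1 + CV / γ) * ((1 - ε) * γ - ε * CV - (Real.sqrt 3 * r * Real.exp r) ^ 2 * (1 + 1 / ε) - θr)⁻¹
            + (Real.sqrt 3 * r * Real.exp r) * (Real.sqrt γ)⁻¹
                * Real.sqrt ((((1 - ε) * γ - ε * CV - (Real.sqrt 3 * r * Real.exp r) ^ 2 * (1 + 1 / ε) - θr)⁻¹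
                    + ((Real.sqrt 3 * r * Real.exp r) ^ 2 * (1 + 1 / ε) + CV + θr) * ((1 - ε) * γ - ε * CV - (Real.sqrt 3 * r * Real.exp r) ^ 2 * (1 + 1 / ε) - θr)⁻¹ ^ 2)
                  / (1 - ε))
            + ((Real.sqrt 3 * r * Real.exp r) ^ 2 + θr) * (Real.sqrt γ)⁻¹ * ((1 - ε) * γ - ε * CV - (Real.sqrt 3 * r * Real.exp r) ^ 2 * (1 + 1 / ε) - θr)⁻¹) * ‖x‖ := by
  intro φ hφ' Mf Mfi hMf hMfi x
  obtain ⟨hρ, hρ', hd₁⟩ := ratio_rows_of_phaseClass F (n := n) (K := K) φ hr hφ'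
  -- the two phase-class letters at `e^{φ}`, majorised by `θ_r`
  have hθV0 : 0 ≤ θr := by
    refine le_trans ?_ hθr
    have : (0 : ℝ) < (F.P K).L := by exact_mod_cast (F.P K).L_pos
    have hc₀ : 0 < c₀ := Fact.out
    have hcB : 0 < cB := Fact.out
    have hL0 : (0 : ℝ) < F.L := by exact_mod_cast lt_trans zero_lt_one F.hL.2
    have hμr : 0 < μ' - r := by linarith
    have hden : 0 < μ' - (r + min 1 ((μ' - r) / 2)) := by
      have := min_le_right (1 : ℝ) ((μ' - r) / 2); linarith
    positivity
  have hVconj : ∀ X : PBond (F.P K) 0 → Matrix (Fin 2) (Fin 2) ℂ,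
      RCLike.re ⟪toL2 F K c₀ X, laplaceA F n K h c₀ cB a (DeltaEtaSlot F n K c₀) U₀ (toL2 F K c₀ X)⟫_ℂ
          - (∑ μ : Fin (F.P K).d, ‖DL2 F n K c₀ U₀ (toL2S F K c₀ (formComp X μ))‖ ^ 2) - θr * ‖toL2 F K c₀ X‖ ^ 2
        ≤ RCLike.re ⟪toL2 F K c₀ (fun b => Real.exp (φ b.src) • X b), laplaceA F n K h c₀ cB a (DeltaEtaSlot F n K c₀) U₀ (toL2 F K c₀ (fun b => (Real.exp (φ b.src))⁻¹ • X b))⟫_ℂ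
          - RCLike.re (∑ μ : Fin (F.P K).d, ⟪DL2 F n K c₀ U₀ (toL2S F K c₀ (formComp (fun b => Real.exp (φ b.src) • X b) μ)),
              DL2 F n K c₀ U₀ (toL2S F K c₀ (formComp (fun b => (Real.exp (φ b.src))⁻¹ • X b) μ))⟫_ℂ) := fun X => by
    have h1 := hVconj_phaseClass_of_letters F h c₀ cB (a := a) hε₀ hε hε12 U₀ hreg ha hr hrμ hCk hk hQ φ hφ' X
    have hX0 : 0 ≤ ‖toL2 F K c₀ X‖ ^ 2 := sq_nonneg _
    nlinarith [h1, mul_le_mul_of_nonneg_right hθr hX0]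
  have hVconj₂ : ∀ X' X'' : PBond (F.P K) 0 → Matrix (Fin 2) (Fin 2) ℂ,
      |RCLike.re ((⟪toL2 F K c₀ (fun b => Real.exp (φ b.src) • X' b),
              laplaceA F n K h c₀ cB a (DeltaEtaSlot F n K c₀) U₀ (toL2 F K c₀ (fun b => (Real.exp (φ b.src))⁻¹ • X'' b))⟫_ℂ
            - ∑ κ : Fin (F.P K).d, ⟪DL2 F n K c₀ U₀ (toL2S F K c₀ (formComp (fun b => Real.exp (φ b.src) • X' b) κ)),
                DL2 F n K c₀ U₀ (toL2S F K c₀ (formComp (fun b => (Real.exp (φ b.src))⁻¹ • X'' b) κ))⟫_ℂ)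
          - (⟪toL2 F K c₀ X', laplaceA F n K h c₀ cB a (DeltaEtaSlot F n K c₀) U₀ (toL2 F K c₀ X'')⟫_ℂ
            - ∑ κ : Fin (F.P K).d, ⟪DL2 F n K c₀ U₀ (toL2S F K c₀ (formComp X' κ)), DL2 F n K c₀ U₀ (toL2S F K c₀ (formComp X'' κ))⟫_ℂ))|
        ≤ θr * ‖toL2 F K c₀ X'‖ * ‖toL2 F K c₀ X''‖ := fun X' X'' => by
    have h1 := hVconj₂_phaseClass_of_letters F h c₀ cB (a := a) hε₀ hε hε12 U₀ hreg ha hr hrμ hCk hk hQ φ hφ' X' X''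
    have hX0 : 0 ≤ ‖toL2 F K c₀ X'‖ * ‖toL2 F K c₀ X''‖ := by positivity
    refine h1.trans ?_
    rw [mul_assoc, mul_assoc θr]
    exact mul_le_mul_of_nonneg_right hθr hX0
  exact conj_resolvent_oneForm_of_letters (h := h) (cB := cB) (a := a) (Δx := DeltaEtaSlot F n K c₀) U₀ hp (fun x => Real.exp (φ x)) (fun _ => Real.exp_pos _) hρ hρ'
    Mf Mfi hMf hMfi (by positivity) hd₁ hγ hCV hθV0 hθV0 hε1p hε1 hΘ hco hVlow hVconj hVconj₂ x

end Summit.QuantumFields.YangMills.Theorems.Prop7OneFormConjugateResolventPhaseClass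

end
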